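import Literature.AlgebraicGeometry.Frobenioids.PadicFrobenioidPairIso
import HarnessLib

/-!
# An equivalence `CosetCat Π₁ ≌ CosetCat Π₂` acts on OBJECTS through the induced `Π₁ ≃ₜ* Π₂`, up to conjugacy

Mochizuki, *The geometry of Frobenioids II*, Kyushu J. Math. **62** (2008), §2, proof of Theorem 2.4 (ii), author's
text p. 21 [cite: MochizukiFrdII2008, Thm 2.4 (ii) p.21] ("`Ψ` induces … `G₁ ⥲ G₂` … well-defined up to composition
with automorphisms … induced by elements of `G₂`"); Mochizuki, *Semi-graphs of anabelioids*, Publ. RIMS **42**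
(2006), Rmk. 3.2.1 p. 35 [cite: MochizukiSemiAnbd2006, Rmk 3.2.1 p.35] (the tempered fundamental group of a connected
temperoid is recovered, up to inner automorphism, from the category).

PROOF-ONLY sequel to abc-iut-L1's `PadicFrobenioidPairIso.lean` (`BaseGaloisSystem.exists_mulEquiv_compatible_of_
cosetCat_equivalence`: an equivalence `E : CosetCat Π₁ ≌ CosetCat Π₂` of the small coset categories of tempered
groups yields `φ : Π₁ ≃* Π₂` compatible with `E` on the deck transformations of a cofinal Galois pro-system).
We add what a consumer of the BASE needs:
* `crightMul_comp_eq_self_iff` — for `q : Π/M → Π/H` with point `c·H`, right translation by `g` fixes `q` iff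
  `c⁻¹ g c ∈ H` (stabilisers of points of `Π/H` are the conjugates of `H`);
* `exists_continuousMulEquiv_forall_obj_conj_of_cosetCat_equivalence` — **the induced `φ` is BICONTINUOUS and
  `E(Π₁/H) ≅ Π₂/φ(H)` for EVERY open `H ⊆ Π₁`, up to conjugacy**: there is `φ : Π₁ ≃ₜ* Π₂` such that for every
  object `X = Π₁/H` some `c ∈ Π₂` satisfies `g ∈ H ↔ c⁻¹ φ(g) c ∈ H'` for all `g`, where `Π₂/H' = E(X)`. (So `E`
  carries the full subcategory of objects on which a closed normal subgroup `Δ ⊆ Π₁` acts trivially onto that of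
  `φ(Δ)` — the form in which [IUTchI] Ex. 3.3 (iii) (a) consumes [AbsAnab] Lem. 1.3.8.)
Pure category / topological-group theory over landed files; nothing of the disputed series is asserted.
-/

noncomputable section

namespace Literature.AlgebraicGeometry.Frobenioids

open CategoryTheory Opposite Topology Filter
open Literature.AnabelianGeometry.SemiGraphs

universe u

namespace BaseGaloisSystem

/-! ### Stabilisers of points of `Π/H` -/

section Stabilisers

variable {G : Type u} [Group G] [TopologicalSpace G]

/-- For `q : Π/M → Π/H` (`M` open normal) with point `pt q = c·H`: right translation `r_g` on `Π/M` fixes `q`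
iff `g·(c·H) = c·H`. [cite: MochizukiSemiAnbd2006, Rmk 3.1.3 p.34] -/
theorem crightMul_comp_eq_self_iff_smul (M : OpenNormalSubgroup G) {Y : CosetCat G} (q : cQ M ⟶ Y) (g : G) :
    crightMul M g ≫ q = q ↔ g • CosetCat.pt q = CosetCat.pt q := by
  constructor
  · intro h
    have h' := congrArg CosetCat.pt h
    rwa [CosetCat.pt_comp, pt_crightMul, CosetCat.toFun_coe] at h'
  · intro h
    exact CosetCat.hom_ext (by rw [CosetCat.pt_comp, pt_crightMul, CosetCat.toFun_coe, h])

/-- For `q : Π/M → Π/H` with point `c·H`: `r_g` fixes `q` iff `c⁻¹ g c ∈ H` (the stabiliser of `c·H` is `cHc⁻¹`).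
[cite: MochizukiSemiAnbd2006, Rmk 3.1.3 p.34] -/
theorem crightMul_comp_eq_self_iff (M : OpenNormalSubgroup G) {Y : CosetCat G} (q : cQ M ⟶ Y) {c : G}
    (hc : CosetCat.pt q = (c : Y.carrier)) (g : G) : crightMul M g ≫ q = q ↔ c⁻¹ * g * c ∈ Y.sg := by
  rw [crightMul_comp_eq_self_iff_smul, hc, MulAction.Quotient.smul_coe, smul_eq_mul, QuotientGroup.eq,
    show (g * c)⁻¹ * c = (c⁻¹ * g * c)⁻¹ by group, inv_mem_iff]
  exact Iff.rfl

/-- `r_g = 𝟙` on `Π/M` iff `g ∈ M`. [cite: MochizukiSemiAnbd2006, Rmk 3.1.3 p.34] -/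
theorem crightMul_eq_id_iff (M : OpenNormalSubgroup G) (g : G) : crightMul M g = 𝟙 (cQ M) ↔ g ∈ M := by
  have h := crightMul_comp_eq_self_iff M (𝟙 (cQ M)) (c := 1) (CosetCat.pt_id _) g
  rw [Category.comp_id, inv_one, one_mul, mul_one] at h
  exact h

end Stabilisers

/-! ### The induced `φ` is bicontinuous and computes `E` on objects up to conjugacy -/

variable {G : Type u} [Group G] [TopologicalSpace G] [IsTopologicalGroup G] (hG : IsTempered G)
  {G₂ : Type u} [Group G₂] [TopologicalSpace G₂] [IsTopologicalGroup G₂] (hG₂ : IsTempered G₂)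

include hG hG₂ in
/-- **An equivalence of small coset categories acts on objects through the induced group isomorphism.**  For
tempered `Π₁` (Galois-countable) and `Π₂` and an equivalence `E : CosetCat Π₁ ≌ CosetCat Π₂` there is a
BICONTINUOUS isomorphism `φ : Π₁ ≃ₜ* Π₂` such that, for every object `X = Π₁/H`, writing `E(X) = Π₂/H'`, some
`c ∈ Π₂` satisfies `g ∈ H ↔ c⁻¹·φ(g)·c ∈ H'` for all `g ∈ Π₁` — i.e. `E(Π₁/H) ≅ Π₂/φ(H)`, the printed "well-defined
up to … automorphisms … induced by elements of `G₂`" being `c`.  (`φ` is abc-iut-L1's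
`exists_mulEquiv_compatible_of_cosetCat_equivalence`; continuity: `φ(N_k) = N₂,k` on the straightened cofinal
systems; objects: `H = {g | r_g ≫ q = q}` for `q : Π₁/N_k → Π₁/H`, transported by `E` and the straightening.)
[cite: MochizukiFrdII2008, Thm 2.4 (ii) p.21] -/
theorem exists_continuousMulEquiv_forall_obj_conj_of_cosetCat_equivalence [SecondCountableTopology G]
    (E : CosetCat G ≌ CosetCat G₂) :
    ∃ φ : G ≃ₜ* G₂, ∀ X : CosetCat G, ∃ c : G₂,
      ∀ g : G, g ∈ X.sg ↔ c⁻¹ * φ g * c ∈ (E.functor.obj X).sg := by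
  obtain ⟨N, hN, hNb⟩ := exists_antitone_cofinal_seq hG
  obtain ⟨N₂, hN₂, hN₂b, ι, φ, hφ⟩ := exists_mulEquiv_compatible_of_cosetCat_equivalence hG hG₂ N hN E hNb
  -- the straightening at level `k`: `j_k : Π₂/N₂,k ≅ E(Π₁/N_k)` with `r_{φ g} ≫ j_k = j_k ≫ E(r_g)`
  let j : ∀ k : ℕ, cQ (N₂ k) ≅ E.functor.obj (cQ (N k)) := fun k => (ι.app k).unop
  have hcomm : ∀ (k : ℕ) (g : G),
      crightMul (N₂ k) (φ g) ≫ (j k).hom = (j k).hom ≫ E.functor.map (crightMul (N k) g) := by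
    intro k g
    have h := congrArg (fun α : Aut (cosetSystem N₂ hN₂) => (α.hom.app k).unop) (hφ g)
    simp only [toAutCoset_hom_app, Iso.conjAut_hom, Iso.conj_apply, NatTrans.comp_app, unop_comp,
      Category.assoc] at h
    change crightMul (N₂ k) (φ g) = (j k).hom ≫ E.functor.map (crightMul (N k) g) ≫ (j k).inv at h
    rw [h, Category.assoc, Category.assoc, Iso.inv_hom_id, Category.comp_id]
  -- `φ(N_k) = N₂,k`
  have hlevel : ∀ (k : ℕ) (g : G), φ g ∈ N₂ k ↔ g ∈ N k := by
    intro k g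
    rw [← crightMul_eq_id_iff, ← crightMul_eq_id_iff]
    constructor
    · intro h
      have h2 := hcomm k g
      rw [h, Category.id_comp] at h2
      have h3 : E.functor.map (crightMul (N k) g) = 𝟙 _ :=
        (cancel_epi (j k).hom).1 (by rw [← h2, Category.comp_id])
      exact E.functor.map_injective (by rw [h3, CategoryTheory.Functor.map_id])
    · intro h
      have h2 := hcomm k g
      rw [h, CategoryTheory.Functor.map_id, Category.comp_id] at h2
      exact (cancel_mono (j k).hom).1 (by rw [h2, Category.id_comp])
  -- continuity of `φ` and `φ⁻¹`
  have hcont : Continuous φ := by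
    refine continuous_of_continuousAt_one φ ?_
    rw [ContinuousAt, map_one]
    intro U hU
    obtain ⟨k, hk⟩ := hN₂b U hU
    exact Filter.mem_map.mpr
      (Filter.mem_of_superset ((N k).toOpenSubgroup.mem_nhds_one) fun g hg => hk ((hlevel k g).2 hg))
  have hcont' : Continuous φ.symm := by
    refine continuous_of_continuousAt_one φ.symm ?_
    rw [ContinuousAt, map_one]
    intro U hU
    obtain ⟨k, hk⟩ := hNb U hU
    refine Filter.mem_map.mpr (Filter.mem_of_superset ((N₂ k).toOpenSubgroup.mem_nhds_one) fun g hg => hk ?_)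
    exact (hlevel k (φ.symm g)).1 (by rwa [MulEquiv.apply_symm_apply])
  refine ⟨{ φ with continuous_toFun := hcont, continuous_invFun := hcont' }, fun X => ?_⟩
  -- objects: `H ⊇ N_k`, `q : Π₁/N_k → Π₁/H` the projection
  obtain ⟨k, hk⟩ := hNb _ X.sg.mem_nhds_one
  let q : cQ (N k) ⟶ X := CosetCat.homMk ((1 : G) : X.carrier) fun u hu =>
    (CosetCat.smul_one_eq_one_iff X u).mpr (hk hu)
  have hq : CosetCat.pt q = ((1 : G) : X.carrier) := CosetCat.pt_homMk _ _
  let q' : cQ (N₂ k) ⟶ E.functor.obj X := (j k).hom ≫ E.functor.map q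
  obtain ⟨c, hc⟩ := QuotientGroup.mk_surjective (CosetCat.pt q')
  refine ⟨c, fun g => ?_⟩
  have h1 : g ∈ X.sg ↔ crightMul (N k) g ≫ q = q := by
    rw [crightMul_comp_eq_self_iff (N k) q hq, inv_one, one_mul, mul_one]
  have key : crightMul (N₂ k) (φ g) ≫ q' = (j k).hom ≫ E.functor.map (crightMul (N k) g ≫ q) := by
    change crightMul (N₂ k) (φ g) ≫ ((j k).hom ≫ E.functor.map q) = _
    rw [← Category.assoc, hcomm k g, Category.assoc, ← CategoryTheory.Functor.map_comp]
  have h2 : crightMul (N₂ k) (φ g) ≫ q' = q' ↔ crightMul (N k) g ≫ q = q := by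
    rw [key]
    constructor
    · intro h
      exact E.functor.map_injective ((cancel_epi (j k).hom).1 h)
    · intro h
      rw [h]
  change g ∈ X.sg ↔ c⁻¹ * φ g * c ∈ (E.functor.obj X).sg
  rw [h1, ← h2, crightMul_comp_eq_self_iff (N₂ k) q' hc.symm]

end BaseGaloisSystem

end Literature.AlgebraicGeometry.Frobenioids

end
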